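import Literature.AlgebraicGeometry.RelativeSpec.GeometricQuotient
import Literature.RingTheory.GaloisAlgebras.ChaseHarrisonRosenberg
import Mathlib.AlgebraicGeometry.Morphisms.Finite
import Mathlib.AlgebraicGeometry.Morphisms.Flat
import Mathlib.AlgebraicGeometry.Morphisms.AffineAnd
import HarnessLib

/-!
# An affine geometric quotient by a free finite group action is finite, flat and surjective

Let a finite group `G` act on a scheme `X` over `Q` (`ρ : ActionOver p G`) such that
`p : X ⟶ Q` is an AFFINE GEOMETRIC QUOTIENT (`ρ.IsGeometricQuotient p`, `IsAffineHom p`;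
Mumford, *Abelian Varieties* §7 Thm. p. 66) and the action is FREE on the affine charts: for
`V ⊆ Q` affine and `g ≠ 1` the elements `g · b - b`, `b ∈ Γ(X, p⁻¹V)`, generate the unit ideal
(Chase–Harrison–Rosenberg). Then on every affine chart `A = Γ(Q, V) ↪ B = Γ(X, p⁻¹V)` is a
`G`-Galois extension of commutative rings with `B^G = A`, so `B` is a finite projective
`A`-module (`GaloisAlgebras.finite_of_free`, `projective_of_free`, `flat_of_free`), whence:

* `ActionOver.IsGeometricQuotient.finite_app_of_free`, `flat_app_of_free` — `Γ(Q, V) → Γ(X, p⁻¹V)`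
  is finite and flat for `V` affine;
* `ActionOver.IsGeometricQuotient.isFinite_of_free` — `p` is finite;
* `ActionOver.IsGeometricQuotient.flat_of_free` — `p` is flat (so `p` is finite locally free:
  `X` is a `G`-torsor over `Q` in the fppf sense; SGA 3 V 4.1, Mumford §12).

This is the intrinsic (`IsGeometricQuotient`) form of `RelativeSpec/FreeQuotient`
(`isFinite_toQuotient`, `flat_toQuotient` for the tree's own `X ⟶ X/G`); it discharges the
hypothesis `[Flat p]` of `RelativeSpec/EquivariantModuleDescentUnique` ((T2) uniqueness of
Galois descent) and of `RelativeSpec/GeometricQuotientFlatBaseChange` for such quotients.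
Everything is proved; no named facts, no definitions.

## References

* [MumfordAV1970] D. Mumford, *Abelian Varieties* (1970), §7 Thm. p. 66, §12 Thm. 1 (p. 112).
* [Greither1992CyclicGalois] C. Greither, LNM 1534 (1992), Ch. 0 Thm. 1.6 (iii), Lemma 1.9.
-/

noncomputable section

universe u

open CategoryTheory Limits AlgebraicGeometry TopologicalSpace Opposite

namespace Literature.AlgebraicGeometry.RelativeSpec.ActionOver.IsGeometricQuotient

variable {X Q : Scheme.{u}} {p : X ⟶ Q} {G : Type u} [Group G] {ρ : ActionOver p G}
variable [Fintype G] (hq : ρ.IsGeometricQuotient p)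
include hq

/-- **On a free chart the quotient map is finite**: for `V ⊆ Q` with the free condition on
`Γ(X, p⁻¹V)`, the ring map `Γ(Q, V) → Γ(X, p⁻¹V)` is finite (`B` is generated over `B^G = A` by
a dual family; Greither Ch. 0 Thm. 1.6 (iii), `GaloisAlgebras.finite_of_free`).
[cite: Greither1992CyclicGalois, Ch. 0 Thm. 1.6 (iii) (pp. 3–4)] -/
theorem finite_app_of_free {V : Q.Opens}
    (hfreeV : ∀ g : G, g ≠ 1 →
      Ideal.span (Set.range fun b : Γ(X, p ⁻¹ᵁ V) ↦ ρ.act g V b - b) = ⊤) :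
    (p.app V).hom.Finite := by
  letI : Algebra Γ(Q, V) Γ(X, p ⁻¹ᵁ V) := (p.app V).hom.toAlgebra
  letI : MulSemiringAction G Γ(X, p ⁻¹ᵁ V) := ρ.mulSemiringAction V
  haveI : SMulCommClass G Γ(Q, V) Γ(X, p ⁻¹ᵁ V) :=
    ⟨fun g a b => by
      change ρ.act g V (p.app V a * b) = p.app V a * ρ.act g V b
      rw [map_mul, ρ.act_app]⟩
  haveI : Algebra.IsInvariant Γ(Q, V) Γ(X, p ⁻¹ᵁ V) G :=
    ⟨fun b hb => hq.exists_app_eq V b fun g _ => hb g⟩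
  haveI : FaithfulSMul Γ(Q, V) Γ(X, p ⁻¹ᵁ V) :=
    (faithfulSMul_iff_algebraMap_injective _ _).mpr (hq.app_injective V)
  have h : Module.Finite Γ(Q, V) Γ(X, p ⁻¹ᵁ V) :=
    Literature.RingTheory.GaloisAlgebras.finite_of_free Γ(Q, V) G hfreeV
  exact RingHom.finite_algebraMap.mpr h

/-- **On a free chart the quotient map is flat**: for `V ⊆ Q` with the free condition on
`Γ(X, p⁻¹V)`, the ring map `Γ(Q, V) → Γ(X, p⁻¹V)` is flat (`B` is a projective `A`-module;
Greither Ch. 0 Thm. 1.6 (iii) / Lemma 1.9, `GaloisAlgebras.flat_of_free`).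
[cite: Greither1992CyclicGalois, Ch. 0 Lemma 1.9 (p. 5)] -/
theorem flat_app_of_free {V : Q.Opens}
    (hfreeV : ∀ g : G, g ≠ 1 →
      Ideal.span (Set.range fun b : Γ(X, p ⁻¹ᵁ V) ↦ ρ.act g V b - b) = ⊤) :
    (p.app V).hom.Flat := by
  letI : Algebra Γ(Q, V) Γ(X, p ⁻¹ᵁ V) := (p.app V).hom.toAlgebra
  letI : MulSemiringAction G Γ(X, p ⁻¹ᵁ V) := ρ.mulSemiringAction V
  haveI : SMulCommClass G Γ(Q, V) Γ(X, p ⁻¹ᵁ V) :=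
    ⟨fun g a b => by
      change ρ.act g V (p.app V a * b) = p.app V a * ρ.act g V b
      rw [map_mul, ρ.act_app]⟩
  haveI : Algebra.IsInvariant Γ(Q, V) Γ(X, p ⁻¹ᵁ V) G :=
    ⟨fun b hb => hq.exists_app_eq V b fun g _ => hb g⟩
  haveI : FaithfulSMul Γ(Q, V) Γ(X, p ⁻¹ᵁ V) :=
    (faithfulSMul_iff_algebraMap_injective _ _).mpr (hq.app_injective V)
  have h : Module.Flat Γ(Q, V) Γ(X, p ⁻¹ᵁ V) :=
    Literature.RingTheory.GaloisAlgebras.flat_of_free Γ(Q, V) G hfreeV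
  exact RingHom.flat_algebraMap_iff.mpr h

variable [IsAffineHom p]
  (hfree : ∀ (V : Q.Opens), IsAffineOpen V → ∀ g : G, g ≠ 1 →
    Ideal.span (Set.range fun b : Γ(X, p ⁻¹ᵁ V) ↦ ρ.act g V b - b) = ⊤)
include hfree

/-- **An affine geometric quotient by a free finite group action is a finite morphism**
(Mumford, *Abelian Varieties* §7 Thm. p. 66 and §12: `X → X/G` is finite; here for any
`p` satisfying the intrinsic characterisation `IsGeometricQuotient`, chartwise by
Chase–Harrison–Rosenberg). [cite: MumfordAV1970, §7 Thm. p. 66 and §12 Thm. 1 (p. 112)] -/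
theorem isFinite_of_free : IsFinite p where
  finite_app V hV := hq.finite_app_of_free (hfree V hV)

/-- **An affine geometric quotient by a free finite group action is flat** (hence, being
finite and of finite presentation chartwise, finite locally free: `X` is a `G`-torsor over `Q`;
Mumford §12, SGA 3 V 4.1). Flatness is affine-local on the target for the affine morphism
`p` (Mathlib `targetAffineLocally_affineAnd_iff'` / `…_iff_affineLocally` for `RingHom.Flat`)
and holds on the charts by `flat_app_of_free`. This discharges the hypothesis `[Flat p]` of
`RelativeSpec/EquivariantModuleDescentUnique.descent_unique_of_free`.
[cite: MumfordAV1970, §12 Thm. 1 (p. 112)] -/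
theorem flat_of_free : Flat p := by
  have h1 : targetAffineLocally (affineAnd RingHom.Flat) p :=
    (targetAffineLocally_affineAnd_iff' RingHom.Flat.respectsIso p).mpr
      ⟨inferInstance, fun V hV => hq.flat_app_of_free (hfree V hV)⟩
  have h2 := (targetAffineLocally_affineAnd_iff_affineLocally RingHom.Flat.propertyIsLocal p).mp h1
  rw [HasRingHomProperty.eq_affineLocally (P := @Flat)]
  exact h2.2

end Literature.AlgebraicGeometry.RelativeSpec.ActionOver.IsGeometricQuotient

end
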